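import Summits.BirchSwinnertonDyer.Uniform.UI.X7SignedMainConjecture
import Summits.BirchSwinnertonDyer.BirchSwinnertonDyer.Theses.SignedLowerHalves
import Summits.BirchSwinnertonDyer.Rank1Residual.Supersingular.KobayashiMainConjectureX7FouquetWan
import HarnessLib

/-!
# UI-X7 scored: the pocket conjecture `X7SignedMainConjecture` placed inside route K3
# `SignedLowerHalves`, its CM part discharged from the published record, its reduction — modulo the
# one PREPRINT claim that reaches non-square-free level (Fouquet–Wan 2021) — to a NAMED residual
# conjecture, and an image-free rank-zero BSD consumer (cell `bsd-uniform`, seat `ui-x7`, prover gen 2)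

HONEST FRAMING. What this file IS: bookkeeping theorems about the labelled conjecture
`X7SignedMainConjecture` (landed byte-identically from planner gen 0, p446184), plus ONE further labelled
conjecture `X7SignedMainConjectureResidue` (a `def … : Prop`, nothing asserted, no axiom, no `sorry`) —
the part of UI-X7 for which NO proof is claimed anywhere in print, not even as a preprint: non-CM `E`,
odd good supersingular `p` with `a_p = 0`, `E` not semistable, and NO prime `ℓ ≠ p` of non-split
multiplicative reduction at which `E[p]` ramifies (the complement of the "Fouquet–Wan locus").
What it is NOT: not a theorem about any curve, not a uniform theorem, not a summit claim; nothing is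
booked; the Fouquet–Wan theorem enters ONLY as the tree's explicitly labelled OPEN hypothesis
`FouquetWan2021_thm51_via_kobayashi74_OPEN` (UNREFEREED preprint arXiv:2107.13726, Thm. 5.1, read
through Kobayashi 2003 Thm. 7.4), Pollack–Rubin 2004 ONLY as the tree's named published fact
`PollackRubin2004.mainTheorem_signedCharIdeal_eq_of_cm` taken as a hypothesis. Pocket X7 stays
CONSTRUCTION-SHAPED.

CONTENT.
§1 UI-X7 inside the live route `route-BirchSwinnertonDyer-SignedLowerHalves` (cell `bsd-ssimc`): the
  route's aside `KobayashiConjecture` (item stmt-BirchSwinnertonDyer-19279, Kobayashi's conjecture for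
  every `E`, `∀`-closure) IMPLIES UI-X7 (restriction to `ClassX7`), and UI-X7 IMPLIES cruxes 3 and 4
  (`KobayashiLowerHalfLargeImage`, item …-19001; `KobayashiMainConjectureSmallImage`, item …-19002) —
  so in the kernel UI-X7 = "X_B2 restricted to X7, both signs, any image" sits exactly between them.
§2 The CM part of UI-X7 is the published record (Pollack–Rubin 2004, via the tree adapter
  `kobayashiMainConjecture_of_pollackRubin_of_goodSS`): granted that named fact, UI-X7 ⟺ its non-CM part.
§3 SCORING AGAINST PRINT (erratum to gen 0's "nobody announces the non-square-free case", found through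
  cell `bsd-ssimc`'s audit W-lev-9 and re-read first-hand: Fouquet–Wan arXiv:2107.13726 Thm. 5.1
  (p. 53) / Thm. 4.51 (p. 50) CLAIM Kato's main conjecture for `f ∈ S_k(Γ₀(N))`, `N` NOT assumed
  square-free, given `ρ̄_f` absolutely irreducible, `ρ̄_f|G_{ℚ_p}` not `χ̄ ⊕ χ̄_cyc χ̄`, and a prime
  `ℓ ∥ N` with `ρ̄_f|G_ℓ` a ramified extension of `μχ_cyc^{1-k/2}` by `μχ_cyc^{-k/2}`, `μ ≠ 1` — for
  `f = f_E` at an X7 pair: a NON-SPLIT multiplicative `ℓ` with `p ∤ ord_ℓ Δ_min`): granted Pollack–Rubin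
  (PUB) and the Fouquet–Wan binder (PRE), UI-X7 is EQUIVALENT to `X7SignedMainConjectureResidue`.
§4 BSD currency improved over gen 0: an IMAGE-FREE rank-zero consumer (the tree's universal
  supersingular rank-zero skeleton `bsdp_of_kobayashiMainConjecture_of_analyticRank_eq_zero` consumes the
  EQUALITY for one sign; `E[p]` irreducible is Serre Prop. 12 on X7), hence UI-X7 ⇒ `BSD(E,p)` on ALL of
  X7 ∩ {r_an ≤ 1}, any image of `ρ̄_{E,p}`, granted the published typed facts the tree's roads carry.
§5 (module doc only) the gen-0 evidence plan SCORED, numbers in `run/shared/lean/pub/bsd-uniform/ui/X7-CONJECTURE.md`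
  v2: P1 on the 7 165-pair census (cell bsd-ssimc census `x7census.tsv`, sha256 59fc49bc…): (i) pairs with
  a supercuspidal additive prime `ℓ ≥ 5` are 1 175 / 3 664 = 32.07 % of the pairs with an additive prime
  `≥ 5` (pre-registered `< 1/3`: PASS, margin 1.3 pt); (ii) pairs additive at 2 or 3 are 5 336 / 7 165 =
  74.47 % (pre-registered `> 90 %`: FAIL — the naive-height heuristic does not transfer to the conductor-
  ordered rank ≤ 1 census). P2 (shape of the first extension beyond semistable): auxiliary-prime half
  CONFIRMED in shape by Fouquet–Wan's third hypothesis (non-split multiplicative `ℓ`, `E[p]` ramified —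
  a refinement of the tree's `Ram`); local-type half CONTRADICTED as stated: the preprint claims principal-
  series AND supercuspidal additive primes together (its Prop. 7.27 / Cor. 7.28 via Hu, IMRN 2018), while
  the local computation NOT found in print by the bsd-ssimc audit is the potentially-MULTIPLICATIVE type
  (`St ⊗ χ`, `χ` ramified quadratic) — which gen 0's decidable sub-pocket `abelianTameTypeAt` had placed on
  the "reachable" side. The sub-statement `X7AbelianTameSignedMainConjecture` is unaffected as a
  STATEMENT (it is implied by UI-X7); only the prediction about proofs attached to it is re-scored.

WHY THIS IS NOVEL (one sentence, honest): nothing here is new mathematics — the value is the kernel-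
checked PLACEMENT of the pocket conjecture between the live route's aside and cruxes, the discharge of
its CM part by name, and the typed residual statement `X7SignedMainConjectureResidue` that says exactly
which X7 pairs no printed or announced argument reaches (none of which we found stated in print).
-/

set_option autoImplicit false

noncomputable section

open scoped Classical MatrixGroups ModularForm

open CongruenceSubgroup WeierstrassCurve Literature.NumberTheory.EllipticCurves
  Literature.NumberTheory.EllipticCurves.ModularForms
  Literature.NumberTheory.EllipticCurves.Rank1Residual
  Literature.NumberTheory.EllipticCurves.Rank1Residual.Typed
  Literature.NumberTheory.EllipticCurves.Kobayashi2003
  Literature.NumberTheory.EllipticCurves.BurungaleKobayashiOta2024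
  Summit.BirchSwinnertonDyer.Rank1Residual.Supersingular

namespace Summit.BirchSwinnertonDyer.Uniform.UI

/-! ### §1 UI-X7 inside route K3 `SignedLowerHalves` -/

section Route

open Summit.BirchSwinnertonDyer.BirchSwinnertonDyer.Theses.SignedLowerHalves

/-- **Kobayashi's conjecture (the route's aside, item stmt-BirchSwinnertonDyer-19279) implies UI-X7**:
UI-X7 is its restriction to census class X7 (`ClassX7 W p = GoodSS W p ∧ ¬ Semistable W`).
[cite: Kobayashi2003, Conjecture (Main Conjecture) (p. 2)] -/
theorem x7SignedMainConjecture_of_kobayashiConjecture (h : KobayashiConjecture) :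
    X7SignedMainConjecture := by
  unfold KobayashiConjecture at h
  intro W _ _ p _ hp hX hap ε
  exact h W p hp hX.1 hap ε

/-- **UI-X7 implies crux 3 `KobayashiLowerHalfLargeImage` (item stmt-BirchSwinnertonDyer-19001)**: the
Eisenstein half for one sign on the surjective branch is a fragment of the equality for both signs
(tree lemma `kobayashiLowerDivisibility_of_mainConjecture`, witness sign `ε = 1`).
[cite: Kobayashi2003, Conjecture (Main Conjecture) (p. 2)] -/
theorem kobayashiLowerHalfLargeImage_of_x7SignedMainConjecture (h : X7SignedMainConjecture) :
    KobayashiLowerHalfLargeImage := by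
  unfold KobayashiLowerHalfLargeImage
  intro W _ _ p _ hp hX _ hap _
  exact ⟨1, kobayashiLowerDivisibility_of_mainConjecture (h W p hp hX hap 1)⟩

/-- **UI-X7 implies crux 4 `KobayashiMainConjectureSmallImage` (item stmt-BirchSwinnertonDyer-19002)**:
the equality for one sign on the non-surjective branch is a fragment of the equality for both signs on
all of X7 (witness sign `ε = 1`). [cite: Kobayashi2003, Conjecture (Main Conjecture) (p. 2)] -/
theorem kobayashiMainConjectureSmallImage_of_x7SignedMainConjecture (h : X7SignedMainConjecture) :
    KobayashiMainConjectureSmallImage := by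
  unfold KobayashiMainConjectureSmallImage
  intro W _ _ p _ hp hX _ hap _
  exact ⟨1, h W p hp hX hap 1⟩

end Route

/-! ### §2 The CM part is the published record (Pollack–Rubin 2004) -/

section CM

variable (W : WeierstrassCurve ℚ) [W.IsElliptic] [W.IsGloballyMinimal] (p : ℕ) [Fact p.Prime]

/-- **UI-X7 at a CM pair is Pollack–Rubin 2004** (named published fact `hPR`, through the tree adapter
`kobayashiMainConjecture_of_pollackRubin_of_goodSS`): for `W.HasCM`, odd `p`, `ClassX7 W p`, BOTH signs.
Note `ClassX7` does not exclude CM, and a CM curve IS non-semistable (additive at the ramified primes of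
`K`), so these pairs are genuinely in the pocket. CONDITIONAL on the named fact only.
[cite: PollackRubin2004, Theorem (p. 448) = Thm. 7.3] [cite: Kobayashi2003, Conjecture (p. 2)] -/
theorem kobayashiMainConjecture_of_classX7_of_hasCM
    (hPR : PollackRubin2004.mainTheorem_signedCharIdeal_eq_of_cm) (hp : p ≠ 2) (hX : ClassX7 W p)
    (hcm : W.HasCM) (ε : ℤˣ) : KobayashiMainConjecture W p ε :=
  kobayashiMainConjecture_of_pollackRubin_of_goodSS W p hPR hcm hp hX.1 ε

end CM

/-- **Granted Pollack–Rubin 2004, UI-X7 is equivalent to its non-CM part.**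
[cite: PollackRubin2004, Theorem (p. 448) = Thm. 7.3] [cite: Kobayashi2003, Conjecture (p. 2)] -/
theorem x7SignedMainConjecture_iff_nonCM_of_pollackRubin
    (hPR : PollackRubin2004.mainTheorem_signedCharIdeal_eq_of_cm) :
    X7SignedMainConjecture ↔
      ∀ (W : WeierstrassCurve ℚ) [W.IsElliptic] [W.IsGloballyMinimal] (p : ℕ) [Fact p.Prime],
        p ≠ 2 → ClassX7 W p → ¬ W.HasCM → W.frobeniusTrace p = 0 →
        ∀ ε : ℤˣ, KobayashiMainConjecture W p ε := by
  constructor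
  · intro h W _ _ p _ hp hX _ hap ε
    exact h W p hp hX hap ε
  · intro h W _ _ p _ hp hX hap ε
    by_cases hcm : W.HasCM
    · exact kobayashiMainConjecture_of_classX7_of_hasCM W p hPR hp hX hcm ε
    · exact h W p hp hX hcm hap ε

/-! ### §3 Scoring against print: the residual conjecture, and UI-X7 ⟺ residue modulo
Pollack–Rubin (PUB) and Fouquet–Wan Thm. 5.1 (PRE) -/

/-- **CONJECTURE UI-X7-res (nothing asserted): the RESIDUE of UI-X7 — the X7 pairs no printed or
announced argument reaches.** For every NON-CM elliptic curve `E/ℚ` (globally minimal `W`), every odd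
prime `p` with `ClassX7 W p` (good supersingular, `E` not semistable) and `a_p = 0`, such that there is
NO prime `ℓ ≠ p` of non-split multiplicative reduction with `p ∤ ord_ℓ(Δ_min)` (i.e. `(E, p)` is OFF
the hypothesis locus of Fouquet–Wan's Thm. 5.1 — the negated clause is verbatim the locus hypothesis of
the tree's binder `FouquetWan2021_thm51_via_kobayashi74_OPEN`), Kobayashi's signed main conjecture holds
for both signs. Examples of residue pairs: every X7 curve whose multiplicative primes are all split, or
all have `p ∣ ord_ℓ(Δ_min)`, or which has no multiplicative prime at all (`N = ∏ ℓ_i^{f_i}`, all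
`f_i ≥ 2`). In print for this statement: NOTHING (Kobayashi 2003 states the conjecture; BSTW 2024 Thm.
1.3 is semistable; its twist clause reaches `E₀ ⊗ χ_K` with `E₀` semistable, `d_K` coprime to `Np`,
ordinary primes only — such a twist keeps the multiplicative primes of `E₀` multiplicative, and they may
all become split or have `p ∣ ord`, so the twist clause (PRE) may reach a thin part of the residue; it is
not subtracted here because it is itself unrefereed and typed separately in the tree as
`BurungaleSkinnerTianWan2024_thm13_twist_OPEN`). This `def` only NAMES the statement.
[cite: Kobayashi2003, Conjecture (Main Conjecture) (p. 2)]
[cite: FouquetWan2021, Thm. 5.1 (p. 53), third hypothesis; Thm. 4.51 (p. 50)] -/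
@[conjecture] def X7SignedMainConjectureResidue : Prop :=
  ∀ (W : WeierstrassCurve ℚ) [W.IsElliptic] [W.IsGloballyMinimal] (p : ℕ) [Fact p.Prime],
    p ≠ 2 → ClassX7 W p → ¬ W.HasCM → W.frobeniusTrace p = 0 →
    ¬ (∃ (ℓ : ℕ) (_ : Fact ℓ.Prime), ℓ ≠ p ∧ W.HasMultiplicativeReductionAtPrime ℓ ∧
        ¬ W.HasSplitMultiplicativeReductionAtPrime ℓ ∧ ¬ p ∣ padicValInt ℓ W.minimalDiscriminantInt) →
    ∀ ε : ℤˣ, KobayashiMainConjecture W p ε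

/-- UI-X7 implies its residue (restriction of the quantifier).
[cite: Kobayashi2003, Conjecture (Main Conjecture) (p. 2)] -/
theorem x7Residue_of_x7SignedMainConjecture (h : X7SignedMainConjecture) :
    X7SignedMainConjectureResidue :=
  fun W _ _ p _ hp hX _ hap _ ε ↦ h W p hp hX hap ε

/-- **UI-X7 ⟸ Pollack–Rubin (PUB) ∧ Fouquet–Wan Thm. 5.1 ∘ Kobayashi Thm. 7.4 (PRE, the tree's OPEN
binder) ∧ the residue conjecture.** Case split at a pair: CM → `hPR`; non-CM on the Fouquet–Wan locus →
`hFW` (its hypotheses: good reduction = `hX.1.1`, `a_p = 0`, `E[p]` irreducible = Serre Prop. 12 on X7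
(`ClassX7.irr`), the locus clause); otherwise → `hres`. CONDITIONAL; closes nothing; FW stays PRE.
[claim: FouquetWan2021, status: under-review] [cite: PollackRubin2004, Theorem (p. 448) = Thm. 7.3]
[cite: Kobayashi2003, Thm. 7.4 (p. 13) and Conjecture (p. 2)] [cite: Serre1972, §1.11 Prop. 12] -/
theorem x7SignedMainConjecture_of_residue_of_pollackRubin_of_thm51_OPEN
    (hPR : PollackRubin2004.mainTheorem_signedCharIdeal_eq_of_cm)
    (hFW : FouquetWan2021_thm51_via_kobayashi74_OPEN) (hres : X7SignedMainConjectureResidue) :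
    X7SignedMainConjecture := by
  intro W _ _ p _ hp hX hap ε
  by_cases hcm : W.HasCM
  · exact kobayashiMainConjecture_of_classX7_of_hasCM W p hPR hp hX hcm ε
  · by_cases hloc : ∃ (ℓ : ℕ) (_ : Fact ℓ.Prime), ℓ ≠ p ∧ W.HasMultiplicativeReductionAtPrime ℓ ∧
        ¬ W.HasSplitMultiplicativeReductionAtPrime ℓ ∧ ¬ p ∣ padicValInt ℓ W.minimalDiscriminantInt
    · exact hFW W p hp hX.1.1 hap (ClassX7.irr W p hp hX) hloc ε
    · exact hres W p hp hX hcm hap hloc ε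

/-- **Modulo the published CM theorem and the ONE preprint claim at non-square-free level, UI-X7 IS its
named residue**: under `hPR` (Pollack–Rubin 2004, PUB) and `hFW` (Fouquet–Wan 2021 Thm. 5.1 read through
Kobayashi Thm. 7.4, UNREFEREED), `X7SignedMainConjecture ↔ X7SignedMainConjectureResidue`. The honest
one-line status of pocket X7 at conjecture level. CONDITIONAL; closes nothing.
[claim: FouquetWan2021, status: under-review] [cite: PollackRubin2004, Theorem (p. 448) = Thm. 7.3]
[cite: Kobayashi2003, Conjecture (Main Conjecture) (p. 2)] -/
theorem x7SignedMainConjecture_iff_residue_of_pollackRubin_of_thm51_OPEN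
    (hPR : PollackRubin2004.mainTheorem_signedCharIdeal_eq_of_cm)
    (hFW : FouquetWan2021_thm51_via_kobayashi74_OPEN) :
    X7SignedMainConjecture ↔ X7SignedMainConjectureResidue :=
  ⟨x7Residue_of_x7SignedMainConjecture,
    x7SignedMainConjecture_of_residue_of_pollackRubin_of_thm51_OPEN hPR hFW⟩

/-! ### §4 BSD currency, image-free: UI-X7 closes all of X7 ∩ {r_an ≤ 1} granted the published typed facts -/

section Consumers

variable (W : WeierstrassCurve ℚ) [W.IsElliptic] [W.IsGloballyMinimal] (p : ℕ) [Fact p.Prime]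

/-- **X7 ∩ {r_an = 0}, odd `p`, `a_p = 0`, ANY image of `ρ̄_{E,p}`: UI-X7 ⇒ `BSD(E,p)`** through the
tree's universal supersingular rank-zero skeleton `bsdp_of_kobayashiMainConjecture_of_analyticRank_eq_zero`
(the EQUALITY for one sign + Kobayashi Thm. 1.2 + B. D. Kim Cor. 3.15 + Pollack + modularity + GZK;
`E[p]` irreducible is DERIVED on X7, Serre Prop. 12). Improves gen 0's consumer
`bsdp_of_x7SignedMainConjecture_of_analyticRank_eq_zero`, which needed `Surj W p` and Wuthrich Prop. 21.
[cite: PollackRubin2004, Thm. 8.2 and its proof (§8)] [cite: Kobayashi2003, Thm. 1.2 and (3.6) (p. 7)]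
[cite: BDKim2013, Cor. 3.15 (p. 199)] [cite: Serre1972, §1.11 Prop. 12] -/
theorem bsdp_of_x7SignedMainConjecture_of_analyticRank_eq_zero_imageFree (h : X7SignedMainConjecture)
    (h12 : Kobayashi2003.thm12_signedSelmerDual_finite_torsion)
    (hKim : BDKim2013.cor315_signedCharValue_rankZero)
    (hPollack : ∀ {N : ℕ} [NeZero N] {f : CuspForm (CongruenceSubgroup.Gamma0 N) 2},
      pollack_exists_plusMinusPAdicLFunction (W := W) (f := f) (p := p))
    (hmod : nonempty_modularParametrizationData) (hmod' : hasEntireLFunction_rat)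
    (hGZK : rank_eq_analyticRank_of_analyticRank_le_one)
    (hp : p ≠ 2) (hX : ClassX7 W p) (hap : W.frobeniusTrace p = 0) (h0 : W.analyticRank = 0) :
    BSDp W p :=
  bsdp_of_kobayashiMainConjecture_of_analyticRank_eq_zero W p h12 hKim hPollack hmod hmod' hGZK hp
    hX.1.1 hap (ClassX7.irr W p hp hX) h0 (h W p hp hX hap 1)

/-- **X7 ∩ {r_an ≤ 1}, odd `p`, `a_p = 0`, any image: UI-X7 ⇒ `BSD(E,p)`** — both analytic ranks at
once (rank 0: the image-free skeleton above; rank 1: Burungale–Kobayashi–Ota Cor. A.5 via the tree's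
`X7.bsdp_of_kobayashiMainConjecture_of_corA5_of_analyticRank_eq_one`). So the ONE conjecture UI-X7 is
in BSD currency on the WHOLE pocket X7 ∩ {r_an ≤ 1} (census cells N5 and O4 together, Surj and
small-image rows alike), granted only the published typed facts named in the hypotheses.
[cite: BurungaleKobayashiOta2023, App. A Cor. A.5] [cite: Kobayashi2003, Thm. 1.2 and (3.6)]
[cite: BDKim2013, Cor. 3.15 (p. 199)] -/
theorem bsdp_of_x7SignedMainConjecture_of_analyticRank_le_one (h : X7SignedMainConjecture)
    (h12 : Kobayashi2003.thm12_signedSelmerDual_finite_torsion)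
    (hKim : BDKim2013.cor315_signedCharValue_rankZero)
    (hPollack : ∀ {N : ℕ} [NeZero N] {f : CuspForm (CongruenceSubgroup.Gamma0 N) 2},
      pollack_exists_plusMinusPAdicLFunction (W := W) (f := f) (p := p))
    (hA5 : corA5_pPart_of_signedCharIdeal_eq)
    (hmod : nonempty_modularParametrizationData) (hmod' : hasEntireLFunction_rat)
    (hGZK : rank_eq_analyticRank_of_analyticRank_le_one)
    (hp : p ≠ 2) (hX : ClassX7 W p) (hap : W.frobeniusTrace p = 0) (hr : W.analyticRank ≤ 1) :
    BSDp W p := by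
  rcases Nat.le_one_iff_eq_zero_or_eq_one.mp hr with h0 | h1
  · exact bsdp_of_x7SignedMainConjecture_of_analyticRank_eq_zero_imageFree W p h h12 hKim hPollack hmod
      hmod' hGZK hp hX hap h0
  · exact bsdp_of_x7SignedMainConjecture_of_analyticRank_eq_one W p h hA5 hmod' hGZK hp hX hap h1

/-- **The residue conjecture in BSD currency, both ranks**: granted Pollack–Rubin (PUB), the Fouquet–Wan
binder (PRE) and the published typed facts, UI-X7-res ⇒ `BSD(E,p)` on all of X7 ∩ {r_an ≤ 1}, `p` odd,
`a_p = 0`. CONDITIONAL (one PRE binder); closes nothing. [claim: FouquetWan2021, status: under-review]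
[cite: PollackRubin2004, Theorem (p. 448) = Thm. 7.3] [cite: BurungaleKobayashiOta2023, App. A Cor. A.5]
[cite: Kobayashi2003, Thm. 1.2, Thm. 7.4] -/
theorem bsdp_of_x7Residue_of_pollackRubin_of_thm51_OPEN_of_analyticRank_le_one
    (hres : X7SignedMainConjectureResidue)
    (hPR : PollackRubin2004.mainTheorem_signedCharIdeal_eq_of_cm)
    (hFW : FouquetWan2021_thm51_via_kobayashi74_OPEN)
    (h12 : Kobayashi2003.thm12_signedSelmerDual_finite_torsion)
    (hKim : BDKim2013.cor315_signedCharValue_rankZero)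
    (hPollack : ∀ {N : ℕ} [NeZero N] {f : CuspForm (CongruenceSubgroup.Gamma0 N) 2},
      pollack_exists_plusMinusPAdicLFunction (W := W) (f := f) (p := p))
    (hA5 : corA5_pPart_of_signedCharIdeal_eq)
    (hmod : nonempty_modularParametrizationData) (hmod' : hasEntireLFunction_rat)
    (hGZK : rank_eq_analyticRank_of_analyticRank_le_one)
    (hp : p ≠ 2) (hX : ClassX7 W p) (hap : W.frobeniusTrace p = 0) (hr : W.analyticRank ≤ 1) :
    BSDp W p :=
  bsdp_of_x7SignedMainConjecture_of_analyticRank_le_one W p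
    (x7SignedMainConjecture_of_residue_of_pollackRubin_of_thm51_OPEN hPR hFW hres) h12 hKim hPollack hA5
    hmod hmod' hGZK hp hX hap hr

end Consumers

end Summit.BirchSwinnertonDyer.Uniform.UI

end
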